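import Summits.NavierStokesRegularity.FluidComputer.DesignSpectralRadius

/-!
# CoboundaryCertificate — a bounded GAUGE splits every level's log-gain into a TRANSFERABLE part `ψ`
# and a COBOUNDARY; a ceiling on `ψ` is a dual certificate for window depth, design rate and "no machine"
# (FLUID COMPUTER cell, idea-1 gen 20, P-G20-1)

HONEST FRAMING: low prior, high value-of-information experiment on Tao's machine paradigm;
NOT a claim that NS blows up.

Dictionary (cell files `pub-fluidc-idea-1/cobound/COBOUNDARY.md`, `PREREG-R2.md` §10bg, `atlas/IDEA-1.md` §24).
On the band manifold the renormalised level map `M` of `RGFixedPoint` hands level `k+1` the state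
`v_{k+1} = M v_k`; the rung reads the one-level sup-velocity gain `g_k = gain v_k` and the floor is
`λ ≤ g_k`.  Any real function `V` on states (a GAUGE; in the cell `V = log F`, `F` = the renormalised in-band
peak factor `U_sup / √(2E₀) ∈ [1, √308]`) splits the log-gain EXACTLY as
`log g(w) = ψ_V(w) + (V (M w) - V w)`: a COBOUNDARY along the orbit, which telescopes and is bounded by the
oscillation of `V` at every depth, plus the TRANSFERABLE log-gain `ψ_V` (the output's sup measured in the
units of the state actually handed on).  This file types the bookkeeping, over an abstract `LevelMap`;
nothing about Navier–Stokes is asserted: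

* `cumLog_eq_sum_psi` — the telescoping identity `cumLog v k = Σ_{i<k} ψ_V(Mⁱ v) + (V (Mᵏ v) - V v)`;
* `cumLog_le_of_gauge` — WEAK DUALITY: a gauge of oscillation `≤ B` with `ψ_V ≤ s` everywhere bounds every
  seed's `k`-level cumulative log-gain by `k·s + B`; hence `design_le_of_gauge`, `designRate_le_of_gauge`
  (`log ρ⋆ ≤ s`: every gauge CAPS the design spectral radius of `DesignSpectralRadius`), the window bound
  `window_depth_le_of_gauge` (`K` consecutive floor levels force `K ≤ B / (log λ - s)` when `s < log λ`) and
  `no_machine_of_gauge` (then no seed is even an eventual machine) — with NO separate log-gain ceiling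
  hypothesis (`logCeiling_of_gauge`: the gauge supplies one, `B' = s + B`);
* `cumLog_le_of_cycle`, `log_lam_le_of_machine_cycle` — on a `p`-cycle of `M` the coboundary VANISHES: a
  periodic (discretely self-similar) machine needs `log λ ≤ s` outright, whatever `B` — "a fixed point cannot
  collect the coboundary" (COBOUNDARY.md (iv));
* `gauge_complete` — COMPLETENESS for uniform finite-depth bounds: conversely, if every seed obeys
  `cumLog v k ≤ k·s + B` at every depth, the dynamic-programming value `w ↦ -⨆ₖ (cumLog w k - k·s)` IS a gauge
  of oscillation `≤ B` with `ψ ≤ s`; so bounded gauges certify exactly the uniform affine bounds;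
* `exists_gauge_of_designRate_lt`, `designRate_lt_iff_gauge`, `exists_kill_depth_iff_gauge` — STRONG DUALITY
  (the discrete dual formula): under a log-gain ceiling and the Fekete hypotheses every `s > log ρ⋆` IS the
  `ψ`-ceiling of a bounded gauge (Fekete makes `design k ≤ k·s` from some depth on, the finitely many earlier
  depths fix the purse `B`, `gauge_complete` does the rest), so `log ρ⋆ = inf {s | some bounded gauge has
  ψ ≤ s}` (infimum not attained in general) and, with `DesignSpectralRadius.designRate_lt_iff`, a FINITE-DEPTH
  DESIGN KILL (`Q_k⋆ < λᵏ` at some `k`) EXISTS IFF A STRICT GAUGE CERTIFICATE (`ψ`-ceiling `< log λ`) EXISTS —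
  the primal certificate of gen 19 and the dual certificate of gen 20 decide the same thing;
* `exists_gauge_iff_bounded_defect`, `designRate_attained_iff` — ATTAINMENT: a bounded gauge with
  `ψ`-ceiling EXACTLY `s` exists iff the defect `cumLog v k - k·s` is uniformly bounded above (then the
  dynamic-programming gauge attains); at `s = log ρ⋆` this is the discrete analogue of 'a calibrated
  sub-action exists' (always, in the continuous expanding case) and of 'non-defective ⇔ an extremal norm
  exists' for the joint spectral radius; `psiCeiling_of_log_gain_le` — ROBUSTNESS: for two level maps with
  the same `M` whose log-gains differ by `≤ ε` pointwise, a `ψ`-ceiling `s` for one is a `ψ`-ceiling `s + ε`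
  for the other under the same gauge;
* numerical pins of the cell's record (`λ = 2`, `F ≤ √308` ⇒ `B = ½ log 308 = 2.865`): `pin_subcritical`
  (the certified optimum's transferable gain `e^{0.469} < 2`: in `ψ`-currency the optimum is sub-critical,
  `r_ψ = 0.80`) and `pin_depth14` (IF `sup ψ ≤ 0.473` — the largest MEASURED `ψ`, NOT a measured supremum —
  no seed passes the floor on 14 consecutive levels: `½ log 308 < 14 (log 2 - 0.473)`).

Caveats typed as hypotheses, not hidden: `GaugeBound` (oscillation of the gauge; in the cell from
`1 ≤ F ≤ √(#in-band modes)`), `PsiCeiling` (a UNIFORM bound on `ψ_V`; the record measures `ψ` on 68 deposited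
states only — `max ψ = 0.473` is a lower estimate of `sup ψ`, and every depth / rate consequence is
conditional on the ceiling, exactly like `DesignSpectralRadius.LogCeiling`); `BddBelow` of `design k / k`
where the rate is compared (`DesignSpectralRadius.bddBelow_design_div` gives it from one seed).

Nearest prior art (prose; searched 2026-08-24, corpus fts+vec and galaxy): the identity is the cohomological
equation / Livšic coboundary of a cocycle over a map; the certificate is the easy ("weak") half of the DUAL
FORMULA of ergodic optimisation, `β(A) = inf_V sup_x (A + V∘M - V)(x)` with equality attained by a SUB-ACTION
(Mañé 1992/1996; Bousch 2000/2001; Conze–Guivarc'h; Garibaldi, *Ergodic Optimization in the Expanding Case*,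
SpringerBriefs 2017 [galaxy:panama:257552008871963], Def. 1.B p.6, Prop. 2.1 p.10, Thm. 2.3 p.11; Jenkinson's
surveys 2006/2019; Bochi 2025 [galaxy:pdf:5004262220]); for matrix families it is the extremal / Barabanov
norm bound on the joint spectral radius (Rota–Strang 1960; Barabanov 1988; Morris arXiv:1905.00749).  The
completeness lemma is the standard dynamic-programming value function (a discrete Mañé potential) and the
strong-duality statement is the discrete, non-attained form of Garibaldi's Thm. 2.3 for the pair
(level map, log-gain), proved here from Fekete rather than from a fixed point of a Lax–Oleinik operator.  None of
these is typed over a cascade level map in the tree (`DesignSpectralRadius.lean` is the primal/Fekete side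
only).  0 sorry; elementary.  Staged by planner seat pub-fluidc-idea-1 gen 20
(HOME/pub-fluidc-idea-1/lean/CoboundaryCertificate.lean); intended home
`Summits/NavierStokesRegularity/FluidComputer/CoboundaryCertificate.lean` (filing is the literature seat's call).
Filed by `pub-fluidc-lit` gen 44 (LEAN ASK #13, HOME/STATUS.md l.4694–l.4697; staged v3 sha16 `8ecd87e10368afe3`, 398 l.): statements/proofs byte-identical, this line added; `GaugeBound`/`PsiCeiling` are hypothesis predicates taken as explicit arguments, never asserted.
-/

noncomputable section

open Filter Topology Function Finset

namespace Summit.NavierStokesRegularity.FluidComputer.CoboundaryCertificate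

open RGFixedPoint DesignSpectralRadius

variable {X : Type*} (Φ : LevelMap X)

/-! ## Gauge, coboundary and transferable log-gain -/

/-- The COBOUNDARY of the gauge `V` at the state `w`: `V (M w) - V w`. -/
def cobdry (V : X → ℝ) (w : X) : ℝ := V (Φ.M w) - V w

/-- The TRANSFERABLE log-gain of `w` in the gauge `V`: `ψ_V(w) = log gain(w) - (V (M w) - V w)`. -/
def psi (V : X → ℝ) (w : X) : ℝ := Real.log (Φ.gain w) - cobdry Φ V w

/-- A gauge of OSCILLATION at most `B`: `V w - V w' ≤ B` for all states.  A modelling hypothesis, consumed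
as `(hV : GaugeBound V B)`; in the cell `V = log F` with `1 ≤ F ≤ √308`. [folklore] -/
def GaugeBound (V : X → ℝ) (B : ℝ) : Prop := ∀ w w', V w - V w' ≤ B

/-- A uniform CEILING on the transferable log-gain: `ψ_V ≤ s` everywhere.  A modelling hypothesis, consumed
as `(hs : PsiCeiling Φ V s)`; nothing in this file asserts it of any level map. [folklore] -/
def PsiCeiling (V : X → ℝ) (s : ℝ) : Prop := ∀ w, psi Φ V w ≤ s

/-- The split is exact: `log g = ψ + coboundary`. -/
theorem log_gain_eq (V : X → ℝ) (w : X) :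
    Real.log (Φ.gain w) = psi Φ V w + cobdry Φ V w := by
  unfold psi; ring

/-- The coboundary read along the orbit: at `Mⁱ v` it is `V (Mⁱ⁺¹ v) - V (Mⁱ v)`. -/
theorem cobdry_iterate (V : X → ℝ) (v : X) (i : ℕ) :
    cobdry Φ V (Φ.M^[i] v) = V (Φ.M^[i + 1] v) - V (Φ.M^[i] v) := by
  have h : Φ.M^[i + 1] v = Φ.M (Φ.M^[i] v) := Function.iterate_succ_apply' Φ.M i v
  unfold cobdry
  rw [h]

/-- **Telescoping**: the coboundaries of `k` consecutive levels sum to `V (Mᵏ v) - V v`. -/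
theorem sum_cobdry (V : X → ℝ) (v : X) (k : ℕ) :
    ∑ i ∈ range k, cobdry Φ V (Φ.M^[i] v) = V (Φ.M^[k] v) - V v := by
  simp_rw [cobdry_iterate]
  have h := Finset.sum_range_sub (fun i => V (Φ.M^[i] v)) k
  simpa using h

/-- **The identity**: `cumLog v k = Σ_{i<k} ψ_V(Mⁱ v) + (V (Mᵏ v) - V v)` for EVERY gauge `V`. -/
theorem cumLog_eq_sum_psi (V : X → ℝ) (v : X) (k : ℕ) :
    cumLog Φ v k = ∑ i ∈ range k, psi Φ V (Φ.M^[i] v) + (V (Φ.M^[k] v) - V v) := by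
  rw [← sum_cobdry Φ V v k, ← sum_add_distrib]
  unfold cumLog
  refine sum_congr rfl fun i _ => ?_
  show Real.log (Φ.gain (Φ.M^[i] v)) = psi Φ V (Φ.M^[i] v) + cobdry Φ V (Φ.M^[i] v)
  exact log_gain_eq Φ V _

/-- One more level from the seed: `cumLog w (k+1) = log gain(w) + cumLog (M w) k`. -/
theorem cumLog_succ (w : X) (k : ℕ) :
    cumLog Φ w (k + 1) = Real.log (Φ.gain w) + cumLog Φ (Φ.M w) k := by
  rw [show k + 1 = 1 + k from Nat.add_comm k 1, cumLog_add]
  simp [cumLog, LevelMap.levelGain]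

variable {Φ}

/-! ## Weak duality: every bounded gauge is a certificate -/

/-- **Weak duality.**  A gauge of oscillation `≤ B` with `ψ_V ≤ s` bounds EVERY seed's `k`-level cumulative
log-gain: `cumLog v k ≤ k·s + B` (the coboundary is paid once, the transferable part once per level). -/
theorem cumLog_le_of_gauge {V : X → ℝ} {B s : ℝ} (hV : GaugeBound V B) (hs : PsiCeiling Φ V s)
    (v : X) (k : ℕ) : cumLog Φ v k ≤ k * s + B := by
  rw [cumLog_eq_sum_psi Φ V]
  have h1 : ∑ i ∈ range k, psi Φ V (Φ.M^[i] v) ≤ k * s :=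
    calc ∑ i ∈ range k, psi Φ V (Φ.M^[i] v) ≤ ∑ _i ∈ range k, s := sum_le_sum fun i _ => hs _
      _ = k * s := by simp
  have h2 := hV (Φ.M^[k] v) v
  linarith

/-- A bounded gauge with a `ψ`-ceiling supplies a log-gain ceiling `s + B` (no separate hypothesis needed). -/
theorem logCeiling_of_gauge {V : X → ℝ} {B s : ℝ} (hV : GaugeBound V B) (hs : PsiCeiling Φ V s) :
    LogCeiling Φ (s + B) := by
  intro w
  have h1 := log_gain_eq Φ V w
  have h2 := hs w
  have h3 := hV (Φ.M w) w
  unfold cobdry at h1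
  linarith

/-- **Window bound (W).**  If `s < log λ`, a window of `K` consecutive floor levels of ANY seed has
`K ≤ B / (log λ - s)`: the floor costs `log λ - s` of coboundary per level and the purse holds `B`. -/
theorem window_depth_le_of_gauge {V : X → ℝ} {B s : ℝ} (hV : GaugeBound V B) (hs : PsiCeiling Φ V s)
    (hslt : s < Real.log Φ.lam) {v : X} {n K : ℕ} (hfloor : ∀ i < K, 1 ≤ Φ.levelRatio v (n + i)) :
    (K : ℝ) ≤ B / (Real.log Φ.lam - s) := by
  have h1 := window_le_cumLog hfloor
  have h2 := cumLog_le_of_gauge hV hs (Φ.M^[n] v) K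
  rw [le_div_iff₀ (sub_pos.mpr hslt), mul_sub]
  linarith

/-- **No machine.**  A bounded gauge with `ψ_V ≤ s < log λ` everywhere: no seed of the manifold generates a
machine, not even eventually. -/
theorem no_machine_of_gauge {V : X → ℝ} {B s : ℝ} (hV : GaugeBound V B) (hs : PsiCeiling Φ V s)
    (hslt : s < Real.log Φ.lam) (v : X) : ¬ (∀ᶠ n in atTop, 1 ≤ Φ.levelRatio v n) := by
  intro hmach
  obtain ⟨N, hN⟩ := eventually_atTop.mp hmach
  obtain ⟨K, hK⟩ := exists_nat_gt (B / (Real.log Φ.lam - s))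
  have hfloor : ∀ i < K, 1 ≤ Φ.levelRatio v (N + i) := fun i _ => hN (N + i) (Nat.le_add_right N i)
  have h := window_depth_le_of_gauge hV hs hslt hfloor
  linarith

/-- Every `k`-level design optimum is capped by the gauge: `design k ≤ k·s + B`. -/
theorem design_le_of_gauge [Nonempty X] {V : X → ℝ} {B s : ℝ} (hV : GaugeBound V B)
    (hs : PsiCeiling Φ V s) (k : ℕ) : design Φ k ≤ k * s + B :=
  ciSup_le fun v => cumLog_le_of_gauge hV hs v k

/-- **Every gauge caps the design spectral radius**: `log ρ⋆ ≤ s` (the `B / k` excess vanishes in the rate). -/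
theorem designRate_le_of_gauge [Nonempty X] {V : X → ℝ} {B s : ℝ} (hV : GaugeBound V B)
    (hs : PsiCeiling Φ V s) (hbdd : BddBelow (Set.range fun k : ℕ => design Φ k / k)) :
    designRate Φ ≤ s := by
  refine le_of_forall_pos_lt_add fun ε hε => ?_
  obtain ⟨k, hk⟩ := exists_nat_gt (B / ε)
  have hk1 : (0 : ℝ) < (k + 1 : ℕ) := by positivity
  have hmem : design Φ (k + 1) / ((k + 1 : ℕ) : ℝ) ∈ (fun k : ℕ => design Φ k / k) '' Set.Ici 1 :=
    ⟨k + 1, by simp, rfl⟩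
  have hrate : designRate Φ ≤ design Φ (k + 1) / ((k + 1 : ℕ) : ℝ) :=
    csInf_le (hbdd.mono (Set.image_subset_range _ _)) hmem
  have hB : B < (k : ℝ) * ε := (div_lt_iff₀ hε).mp hk
  have hk' : (k : ℝ) * ε < ((k + 1 : ℕ) : ℝ) * ε := by
    refine mul_lt_mul_of_pos_right ?_ hε
    push_cast
    linarith
  have hquot : B / ((k + 1 : ℕ) : ℝ) < ε := by
    rw [div_lt_iff₀ hk1]
    linarith
  calc designRate Φ ≤ design Φ (k + 1) / ((k + 1 : ℕ) : ℝ) := hrate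
    _ ≤ (((k + 1 : ℕ) : ℝ) * s + B) / ((k + 1 : ℕ) : ℝ) := by
        gcongr
        exact design_le_of_gauge hV hs (k + 1)
    _ = s + B / ((k + 1 : ℕ) : ℝ) := by
        field_simp
    _ < s + ε := by linarith

/-! ## Cycles: a fixed point cannot collect the coboundary -/

/-- On a `p`-cycle of `M` the coboundary vanishes: `cumLog v p = Σ ψ ≤ p·s`, whatever the oscillation. -/
theorem cumLog_le_of_cycle {V : X → ℝ} {s : ℝ} (hs : PsiCeiling Φ V s) {v : X} {p : ℕ}
    (hcyc : Φ.M^[p] v = v) : cumLog Φ v p ≤ p * s := by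
  rw [cumLog_eq_sum_psi Φ V, hcyc, sub_self, add_zero]
  calc ∑ i ∈ range p, psi Φ V (Φ.M^[i] v) ≤ ∑ _i ∈ range p, s := sum_le_sum fun i _ => hs _
    _ = p * s := by simp

/-- **A periodic machine needs `log λ ≤ sup ψ`.**  If a `p`-cycle (`p ≥ 1`; a discretely self-similar orbit
with scale `λᵖ`) passes the floor at each of its `p` levels, then `log λ ≤ s` for every gauge's ceiling `s`. -/
theorem log_lam_le_of_machine_cycle {V : X → ℝ} {s : ℝ} (hs : PsiCeiling Φ V s) {v : X} {p : ℕ}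
    (hcyc : Φ.M^[p] v = v) (hp : p ≠ 0) (hfloor : ∀ i < p, 1 ≤ Φ.levelRatio v i) :
    Real.log Φ.lam ≤ s := by
  have h1 : (p : ℝ) * Real.log Φ.lam ≤ cumLog Φ (Φ.M^[0] v) p :=
    window_le_cumLog (n := 0) fun i hi => by simpa using hfloor i hi
  have h1' : (p : ℝ) * Real.log Φ.lam ≤ cumLog Φ v p := by simpa using h1
  have h2 := cumLog_le_of_cycle hs hcyc
  have hp' : (0 : ℝ) < p := Nat.cast_pos.mpr (Nat.pos_of_ne_zero hp)
  exact le_of_mul_le_mul_left (h1'.trans h2) hp'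

/-! ## Completeness: uniform affine bounds come from gauges -/

variable (Φ)

/-- The dynamic-programming gauge of slope `s`: `V_s(w) = -⨆ₖ (cumLog w k - k·s)`. -/
def dpGauge (s : ℝ) (w : X) : ℝ := - ⨆ k : ℕ, (cumLog Φ w k - k * s)

variable {Φ}

/-- Under a uniform bound `cumLog ≤ k·s + B` the value `⨆ₖ (cumLog w k - k·s)` is bounded above by `B`. -/
theorem bddAbove_dp {s B : ℝ} (hbound : ∀ v k, cumLog Φ v k ≤ k * s + B) (w : X) :
    BddAbove (Set.range fun k : ℕ => cumLog Φ w k - k * s) :=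
  ⟨B, by rintro _ ⟨k, rfl⟩; have := hbound w k; simp only; linarith⟩

/-- The value is between `0` (depth `0`) and `B`. -/
theorem dp_mem {s B : ℝ} (hbound : ∀ v k, cumLog Φ v k ≤ k * s + B) (w : X) :
    0 ≤ ⨆ k : ℕ, (cumLog Φ w k - k * s) ∧ (⨆ k : ℕ, (cumLog Φ w k - k * s)) ≤ B := by
  refine ⟨?_, ciSup_le fun k => by have := hbound w k; linarith⟩
  have h := le_ciSup (bddAbove_dp hbound w) 0
  simpa using h

/-- **Completeness.**  If every seed obeys `cumLog v k ≤ k·s + B` at every depth, the dynamic-programming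
gauge has oscillation `≤ B` and transferable ceiling `s`: bounded gauges certify EXACTLY the uniform affine
finite-depth bounds (the discrete Mañé potential; the converse of `cumLog_le_of_gauge`). -/
theorem gauge_complete {s B : ℝ} (hbound : ∀ v k, cumLog Φ v k ≤ k * s + B) :
    GaugeBound (dpGauge Φ s) B ∧ PsiCeiling Φ (dpGauge Φ s) s := by
  refine ⟨fun w w' => ?_, fun w => ?_⟩
  · have h1 := (dp_mem hbound w).1
    have h2 := (dp_mem hbound w').2
    unfold dpGauge
    linarith
  · -- `ψ ≤ s` ⇔ `log gain w + S (M w) ≤ S w + s`, and each `cumLog (M w) k - k s` is a depth-`(k+1)` term at `w`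
    have hS : (⨆ k : ℕ, (cumLog Φ (Φ.M w) k - k * s)) ≤
        (⨆ k : ℕ, (cumLog Φ w k - k * s)) + s - Real.log (Φ.gain w) := by
      refine ciSup_le fun k => ?_
      have hk := le_ciSup (bddAbove_dp hbound w) (k + 1)
      rw [cumLog_succ] at hk
      push_cast at hk
      linarith
    unfold psi cobdry dpGauge
    linarith

/-! ## Strong duality: the design rate is the infimum of gauge ceilings (discrete dual formula)

`designRate_le_of_gauge` says every bounded gauge caps `log ρ⋆` by its `ψ`-ceiling.  Conversely, under a
log-gain ceiling and the Fekete hypotheses, every `s > log ρ⋆` is the `ψ`-ceiling of a bounded gauge — the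
dynamic-programming gauge `dpGauge s`.  So `log ρ⋆ = inf {s | ∃ bounded gauge with ψ ≤ s}` (the infimum
need not be attained: `design k - k·log ρ⋆` may be unbounded), and `ρ⋆ < λ` — the finite-depth kill
criterion `DesignSpectralRadius.designRate_lt_iff` — holds iff a STRICT gauge certificate exists. -/

/-- Fekete ⇒ a uniform AFFINE bound at every slope above the rate: if `log ρ⋆ < s` then, for some purse
`B`, every seed obeys `cumLog v k ≤ k·s + B` at every depth. -/
theorem affine_bound_of_designRate_lt [Nonempty X] {B₀ : ℝ} (hB : LogCeiling Φ B₀)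
    (hbdd : BddBelow (Set.range fun k : ℕ => design Φ k / k)) {s : ℝ} (hs : designRate Φ < s) :
    ∃ B : ℝ, ∀ v k, cumLog Φ v k ≤ k * s + B := by
  have hsub := design_subadditive hB
  have hev : ∀ᶠ k : ℕ in atTop, design Φ k / k < s :=
    (tendsto_designRate hsub hbdd).eventually (gt_mem_nhds hs)
  obtain ⟨K, hK⟩ := eventually_atTop.mp hev
  refine ⟨∑ j ∈ range K, |design Φ j - j * s|, fun v k => ?_⟩
  have hnonneg : 0 ≤ ∑ j ∈ range K, |design Φ j - j * s| := sum_nonneg fun j _ => abs_nonneg _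
  have hvk : cumLog Φ v k ≤ design Φ k := cumLog_le_design hB v k
  by_cases hKk : K ≤ k
  · -- Fekete regime: `design k / k < s`
    have hlt := hK k hKk
    rcases Nat.eq_zero_or_pos k with rfl | hkpos
    · have h0 : design Φ 0 = 0 := design_zero
      simp only [Nat.cast_zero, zero_mul, zero_add]
      linarith
    · have hk' : (0 : ℝ) < k := Nat.cast_pos.mpr hkpos
      have hks : design Φ k < k * s := by rwa [div_lt_iff₀ hk', mul_comm] at hlt
      linarith
  · -- the finitely many early depths are paid from the purse
    have hmem : k ∈ range K := mem_range.mpr (by omega)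
    have h1 : design Φ k - k * s ≤ |design Φ k - k * s| := le_abs_self _
    have h2 : |design Φ k - k * s| ≤ ∑ j ∈ range K, |design Φ j - j * s| :=
      single_le_sum (f := fun j : ℕ => |design Φ j - (j : ℝ) * s|) (fun j _ => abs_nonneg _) hmem
    linarith

/-- **Strong duality (the dual formula, non-attained form).**  Under a log-gain ceiling and the Fekete
hypotheses, every `s > log ρ⋆` is the `ψ`-ceiling of a bounded gauge: the dynamic-programming gauge at
slope `s`.  With `designRate_le_of_gauge`: `log ρ⋆ = inf over bounded gauges of the ψ-ceiling`. -/
theorem exists_gauge_of_designRate_lt [Nonempty X] {B₀ : ℝ} (hB : LogCeiling Φ B₀)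
    (hbdd : BddBelow (Set.range fun k : ℕ => design Φ k / k)) {s : ℝ} (hs : designRate Φ < s) :
    ∃ B : ℝ, GaugeBound (dpGauge Φ s) B ∧ PsiCeiling Φ (dpGauge Φ s) s := by
  obtain ⟨B, hbound⟩ := affine_bound_of_designRate_lt hB hbdd hs
  exact ⟨B, gauge_complete hbound⟩

/-- `log ρ⋆ < c` iff SOME bounded gauge has `ψ`-ceiling `< c`. -/
theorem designRate_lt_iff_gauge [Nonempty X] {B₀ : ℝ} (hB : LogCeiling Φ B₀)
    (hbdd : BddBelow (Set.range fun k : ℕ => design Φ k / k)) {c : ℝ} :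
    designRate Φ < c ↔ ∃ (V : X → ℝ) (B s : ℝ), s < c ∧ GaugeBound V B ∧ PsiCeiling Φ V s := by
  constructor
  · intro hc
    obtain ⟨s, hs, hsc⟩ := exists_between hc
    obtain ⟨B, hV, hψ⟩ := exists_gauge_of_designRate_lt hB hbdd hs
    exact ⟨dpGauge Φ s, B, s, hsc, hV, hψ⟩
  · rintro ⟨V, B, s, hsc, hV, hψ⟩
    exact (designRate_le_of_gauge hV hψ hbdd).trans_lt hsc

/-- **The two certificates decide the same thing.**  A finite-depth DESIGN KILL (`design k < k·log λ`, i.e.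
`Q_k⋆ < λᵏ`, at some depth `k ≥ 1` — the primal certificate of `DesignSpectralRadius`) exists iff a STRICT
GAUGE CERTIFICATE (a bounded gauge with `ψ`-ceiling `< log λ` — the dual certificate of this file) exists. -/
theorem exists_kill_depth_iff_gauge [Nonempty X] {B₀ : ℝ} (hB : LogCeiling Φ B₀)
    (hbdd : BddBelow (Set.range fun k : ℕ => design Φ k / k)) :
    (∃ k : ℕ, 1 ≤ k ∧ design Φ k < k * Real.log Φ.lam) ↔
      ∃ (V : X → ℝ) (B s : ℝ), s < Real.log Φ.lam ∧ GaugeBound V B ∧ PsiCeiling Φ V s :=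
  (designRate_lt_iff (design_subadditive hB) hbdd).symm.trans (designRate_lt_iff_gauge hB hbdd)

/-! ## Attainment = bounded defect; robustness
Over a compact expanding system a CALIBRATED sub-action (a gauge attaining the infimum) always exists (Lax–Oleinik);
over an arbitrary level map one exists at rate `s` iff the DEFECT `cumLog v k - k·s` is uniformly bounded above —
at `s = designRate Φ` this may fail, exactly as a defective matrix family has no extremal norm. -/

/-- **Attainment criterion.**  A bounded gauge with `ψ`-ceiling exactly `s` exists iff the defect
`cumLog v k - k·s` is bounded above uniformly in seeds and depths; the dynamic-programming gauge then attains. -/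
theorem exists_gauge_iff_bounded_defect {s : ℝ} :
    (∃ (V : X → ℝ) (B : ℝ), GaugeBound V B ∧ PsiCeiling Φ V s) ↔
      ∃ B : ℝ, ∀ v k, cumLog Φ v k ≤ k * s + B :=
  ⟨fun ⟨_, B, hV, hs⟩ => ⟨B, cumLog_le_of_gauge hV hs⟩,
    fun ⟨B, hb⟩ => ⟨dpGauge Φ s, B, gauge_complete hb⟩⟩

/-- **Attainment at the design rate**: the infimum `log ρ⋆` of the dual formula is attained by a bounded
gauge iff `cumLog v k ≤ k·designRate + B` uniformly (bounded defect). -/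
theorem designRate_attained_iff :
    (∃ (V : X → ℝ) (B : ℝ), GaugeBound V B ∧ PsiCeiling Φ V (designRate Φ)) ↔
      ∃ B : ℝ, ∀ v k, cumLog Φ v k ≤ k * designRate Φ + B :=
  exists_gauge_iff_bounded_defect

/-- **Robustness to gain error.**  If two level maps share the map `M` and the second's log-gain exceeds the
first's by at most `ε` pointwise, then a `ψ`-ceiling `s` for the first is a `ψ`-ceiling `s + ε` for the second
under the SAME gauge: a transferable-gain ceiling established to pointwise accuracy `ε` certifies `s + ε`. -/
theorem psiCeiling_of_log_gain_le {Φ' : LevelMap X} (hM : Φ'.M = Φ.M) {ε : ℝ}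
    (hε : ∀ w, Real.log (Φ'.gain w) ≤ Real.log (Φ.gain w) + ε) {V : X → ℝ} {s : ℝ}
    (hs : PsiCeiling Φ V s) : PsiCeiling Φ' V (s + ε) := by
  intro w
  have h1 := hs w; have h2 := hε w
  unfold psi cobdry at h1 ⊢; rw [hM]; linarith

/-! ## Numerical pins (cell numbers of record; `λ = 2`, `F ≤ √308`, so `B = ½ log 308`) -/

/-- The certified optimum's TRANSFERABLE gain `e^ψ = e^{0.469}` is below `λ = 2` (`r_ψ = 0.80`): in
fixed-point-consistent currency the level-one optimum is sub-critical (COBOUNDARY.md (i)). -/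
theorem pin_subcritical : Real.exp 0.469 < 2 := by
  rw [← Real.lt_log_iff_exp_lt (by norm_num)]
  have h := Real.log_two_gt_d9
  linarith

/-- IF the transferable ceiling were the largest measured value, `sup ψ ≤ 0.473` (NOT measured as a supremum),
the window bound (W) with `B = ½ log 308` forbids 14 consecutive floor levels: `½ log 308 < 14 (log 2 - 0.473)`
(COBOUNDARY.md (iii): at most 13). -/
theorem pin_depth14 : Real.log 308 / 2 < 14 * (Real.log 2 - 0.473) := by
  have h2 := Real.log_two_gt_d9
  have he := Real.exp_one_gt_d9
  have h6 : Real.exp 1 ^ 6 = Real.exp 6 := by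
    rw [Real.exp_one_pow]
    norm_num
  have h308 : Real.log 308 < 6 := by
    rw [Real.log_lt_iff_lt_exp (by norm_num)]
    calc (308 : ℝ) < 2.7182818283 ^ 6 := by norm_num
      _ < Real.exp 1 ^ 6 := by gcongr
      _ = Real.exp 6 := h6
  linarith

end Summit.NavierStokesRegularity.FluidComputer.CoboundaryCertificate
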